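import Summits.CriticalPhenomena.PercolationContinuityZ3.Theorems.Transplant.CayleyScaledExtensions
import HarnessLib

/-!
# Milnor's kernel lemma, I: the `2^m` words `t a^{ε₁} t a^{ε₂} ⋯ t a^{ε_m}` — in a Cayley graph WITHOUT exponential growth
# all conjugates `t^k a t^{-k}` (`k ∈ ℤ`) lie in the span of finitely many of them

builds on p205010 (kernel theorem, internal audit signed; external expert review pending) — nothing in this file uses p205010, and
nothing here is about percolation: it is the combinatorial half of Milnor's 1968 lemma, proved for the tree's growth predicate
`HasExponentialGrowth (mulCayley ↑S)` of the Cayley graph `Cay(Γ; S) = SimpleGraph.mulCayley ↑S`.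
Lane `prim-bschramm`, seat `prim-bschramm-p4` gen 17 (PART C3 of `P4-GENERAL.md` §39: INPUT(Cay(Γ;S)) as weak as possible — the
finitely-generated-kernel hypothesis of `CayleyScaled.criticalContinuity_of_kerFG` is AUTOMATIC off exponential growth, and ON exponential
growth Hutchcroft's theorem applies; so INPUT(Cay(Γ;S)) = a homomorphism `Γ → ℤ²` of rank-2 image, i.e. `b₁(Γ) ≥ 2`, nothing else).
Helper file (`--supports stmt-CriticalPhenomena-4575`).

MILNOR'S ARGUMENT [Milnor 1968, Lemma 1, pp. 447–448].  Fix `t, a ∈ Γ` and put `c_j := t^j a t^{-j}`.  For `ε ∈ {0,1}^m` the word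
`W(ε) = (t a^{ε₁})(t a^{ε₂}) ⋯ (t a^{ε_m})` equals `c_1^{ε₁} c_2^{ε₂} ⋯ c_m^{ε_m} · t^m` and has `S`-length `≤ m·R` (`R` = a bound for the
lengths of `t` and `a`).  If for every `j < m` the conjugate `c_{j+1}` is NOT in the subgroup `⟨c_0, …, c_j⟩`, the map `ε ↦ W(ε)` is injective
(induction on `m`: compare the last letters), so the ball of radius `m·R` has `≥ 2^m` elements; if this held for every `m`, the Cayley graph
would have exponential growth (`hasExponentialGrowth_of_two_pow_le`).  Hence off exponential growth some `c_n ∈ ⟨c_i : i < n⟩`, and then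
by induction EVERY `c_k`, `k ≥ 0`, lies in `⟨c_i : i < n⟩` (`conj_mem_closure_of_mem`); the same with `t⁻¹` handles `k < 0`
(`exists_finset_conj`).  File II (`CayleyMilnorKernel`) turns this into: the kernel of every homomorphism `Γ → ℤ²` is finitely generated.
* §1 balls of `Cay(Γ;S)`: products, inverses, every element has a length, left translates, `ballVolume` monotone;
* §2 `Milnor.conj`, `Milnor.wordProd` and the telescoped word; §3 independence ⟹ injectivity; §4 propagation `c_n ∈ ⟨c_{<n}⟩ ⟹ ∀ k, c_k ∈ ⟨c_{<n}⟩`;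
* §5 growth: `2^m ≤ |B(x, mR)|` for all `m` ⟹ `HasExponentialGrowth`; §6 the conclusions `exists_conj_mem_closure`, `exists_finset_conj`.
[cite: MilnorSolvableGrowth1968, Lemma 1 pp. 447–448] [cite: Rosset1976, Thm. 1] [cite: Hutchcroft2016, §1 (exponential growth)]
-/

noncomputable section

namespace Summit.CriticalPhenomena.PercolationContinuityZ3.Theorems.Transplant

open SimpleGraph Filter Literature.Barriers.CriticalPhenomena
open scoped Classical

namespace Milnor

variable {Γ : Type} [Group Γ] (S : Finset Γ)

/-! ## §1 Balls of `Cay(Γ; S)` -/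

/-- **Lengths add under products**: `x ∈ B(1,m)`, `y ∈ B(1,n)` ⟹ `xy ∈ B(1,m+n)` (left-translate the walk to `y` by `x` and concatenate).
[cite: MilnorSolvableGrowth1968, p. 447 (growth function g_S)] -/
theorem mul_mem_graphBall {x y : Γ} {m n : ℕ} (hx : x ∈ graphBall (mulCayley (S : Set Γ)) 1 m)
    (hy : y ∈ graphBall (mulCayley (S : Set Γ)) 1 n) : x * y ∈ graphBall (mulCayley (S : Set Γ)) 1 (m + n) := by
  obtain ⟨w₁, hw₁⟩ := hx
  obtain ⟨w₂, hw₂⟩ := hy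
  refine ⟨w₁.append ((w₂.map (leftMulIso S x).toHom).copy (by exact mul_one x) rfl), ?_⟩
  rw [Walk.length_append, Walk.length_copy, Walk.length_map]
  omega

/-- **Lengths are symmetric**: `x ∈ B(1,m)` ⟹ `x⁻¹ ∈ B(1,m)`. [cite: MilnorSolvableGrowth1968, p. 447 (growth function g_S)] -/
theorem inv_mem_graphBall {x : Γ} {m : ℕ} (hx : x ∈ graphBall (mulCayley (S : Set Γ)) 1 m) :
    x⁻¹ ∈ graphBall (mulCayley (S : Set Γ)) 1 m := by
  obtain ⟨w, hw⟩ := hx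
  refine ⟨((w.map (leftMulIso S x⁻¹).toHom).copy (by exact mul_one x⁻¹) (by exact inv_mul_cancel x)).reverse, ?_⟩
  rw [Walk.length_reverse, Walk.length_copy, Walk.length_map]
  exact hw

/-- A generator has length `≤ 1`. [cite: BenjaminiSchramm1996, §2 (Cayley graphs)] -/
theorem mem_graphBall_one_of_mem {s : Γ} (hs : s ∈ S) : s ∈ graphBall (mulCayley (S : Set Γ)) 1 1 := by
  by_cases h1 : s = 1
  · subst h1; exact mem_graphBall_self _ _ _
  · have hadj : (mulCayley (S : Set Γ)).Adj 1 s := by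
      rw [mulCayley_adj]
      exact ⟨Ne.symm h1, Or.inl (by rwa [inv_one, one_mul, Finset.mem_coe])⟩
    exact ⟨hadj.toWalk, by rw [Walk.length_cons, Walk.length_nil]⟩

/-- **Every element of `Γ = ⟨S⟩` has finite `S`-length.** [cite: BenjaminiSchramm1996, §2 (Cayley graphs)] -/
theorem exists_mem_graphBall (hS : Subgroup.closure (S : Set Γ) = ⊤) (g : Γ) :
    ∃ n, g ∈ graphBall (mulCayley (S : Set Γ)) 1 n := by
  have hg : g ∈ Subgroup.closure (S : Set Γ) := by rw [hS]; exact Subgroup.mem_top g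
  induction hg using Subgroup.closure_induction with
  | mem x hx => exact ⟨1, mem_graphBall_one_of_mem S (Finset.mem_coe.1 hx)⟩
  | one => exact ⟨0, mem_graphBall_self _ _ _⟩
  | mul x y _ _ hx hy =>
    obtain ⟨m, hm⟩ := hx
    obtain ⟨n, hn⟩ := hy
    exact ⟨m + n, mul_mem_graphBall S hm hn⟩
  | inv x _ hx =>
    obtain ⟨m, hm⟩ := hx
    exact ⟨m, inv_mem_graphBall S hm⟩

/-- Left translation carries `B(1,n)` into `B(x,n)`. [cite: BenjaminiSchramm1996, §2 (Cayley graphs)] -/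
theorem mul_mem_graphBall_left (x : Γ) {g : Γ} {n : ℕ} (hg : g ∈ graphBall (mulCayley (S : Set Γ)) 1 n) :
    x * g ∈ graphBall (mulCayley (S : Set Γ)) x n := by
  have h := mem_graphBall_map (leftMulIso S x) hg
  rwa [leftMulIso_apply, leftMulIso_apply, mul_one] at h

/-- Ball volumes of a locally finite graph increase with the radius. [folklore] -/
theorem ballVolume_mono {V : Type*} (G : SimpleGraph V) [G.LocallyFinite] (x : V) {m n : ℕ} (h : m ≤ n) :
    ballVolume G x m ≤ ballVolume G x n :=
  Set.ncard_le_ncard (graphBall_mono G x h) (graphBall_finite G x n)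

/-! ## §2 Conjugates `c_j = t^j a t^{-j}` and the ordered products `c_1^{ε₁} ⋯ c_m^{ε_m}` -/

/-- `c_j := t^j a t^{-j}`. [cite: MilnorSolvableGrowth1968, p. 448 (α_k = β^k α β^{-k})] -/
def conj (t a : Γ) (j : ℕ) : Γ := t ^ j * a * (t ^ j)⁻¹

/-- `c_0 = a`. [cite: MilnorSolvableGrowth1968, p. 448] -/
@[simp] theorem conj_zero (t a : Γ) : conj t a 0 = a := by simp [conj]

/-- `c_{j+k} = t^k c_j t^{-k}`. [cite: MilnorSolvableGrowth1968, p. 448 ("conjugating by β")] -/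
theorem conj_add (t a : Γ) (j k : ℕ) : conj t a (j + k) = t ^ k * conj t a j * (t ^ k)⁻¹ := by
  simp only [conj, pow_add]
  group

/-- `c_j(t, a) = t^j a (t^j)⁻¹` with an INTEGER exponent. [cite: MilnorSolvableGrowth1968, p. 448] -/
theorem conj_eq_zpow (t a : Γ) (j : ℕ) : conj t a j = t ^ (j : ℤ) * a * (t ^ (j : ℤ))⁻¹ := by
  simp [conj, zpow_natCast]

/-- `c_j(t⁻¹, a) = t^{-j} a (t^{-j})⁻¹`. [cite: MilnorSolvableGrowth1968, p. 448 (α_k with k < 0)] -/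
theorem conj_inv_eq_zpow (t a : Γ) (j : ℕ) : conj t⁻¹ a j = t ^ (-(j : ℤ)) * a * (t ^ (-(j : ℤ)))⁻¹ := by
  simp [conj, zpow_neg, zpow_natCast, inv_pow]

/-- The ordered product `P_m(ε) = c_1^{ε₀} c_2^{ε₁} ⋯ c_m^{ε_{m−1}}` (`ε : Fin m → Bool`).
[cite: MilnorSolvableGrowth1968, p. 448 (the relation α_1^{i_1} ⋯ α_m^{i_m})] -/
def wordProd (t a : Γ) : (m : ℕ) → (Fin m → Bool) → Γ
  | 0, _ => 1
  | m + 1, ε => wordProd t a m (Fin.init ε) * (if ε (Fin.last m) then conj t a (m + 1) else 1)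

/-- **The telescoped word**: `P_m(ε) · t^m = (t a^{ε₀}) ⋯ (t a^{ε_{m−1}})` has `S`-length `≤ m (r_t + r_a)`.
[cite: MilnorSolvableGrowth1968, p. 447 (the 2^m expressions βα^{i_1} ⋯ βα^{i_m})] -/
theorem wordProd_mul_pow_mem (t a : Γ) {rt ra : ℕ} (ht : t ∈ graphBall (mulCayley (S : Set Γ)) 1 rt)
    (ha : a ∈ graphBall (mulCayley (S : Set Γ)) 1 ra) :
    ∀ (m : ℕ) (ε : Fin m → Bool), wordProd t a m ε * t ^ m ∈ graphBall (mulCayley (S : Set Γ)) 1 (m * (rt + ra))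
  | 0, ε => by
    rw [wordProd, pow_zero, mul_one, Nat.zero_mul]
    exact mem_graphBall_self _ _ _
  | m + 1, ε => by
    have ih := wordProd_mul_pow_mem t a ht ha m (Fin.init ε)
    have hstep : t * (if ε (Fin.last m) then a else 1) ∈ graphBall (mulCayley (S : Set Γ)) 1 (rt + ra) := by
      refine mul_mem_graphBall S ht ?_
      split_ifs
      · exact ha
      · exact mem_graphBall_self _ _ _
    have heq : wordProd t a (m + 1) ε * t ^ (m + 1) =
        (wordProd t a m (Fin.init ε) * t ^ m) * (t * (if ε (Fin.last m) then a else 1)) := by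
      simp only [wordProd, conj]
      split_ifs <;> group
    rw [heq, show (m + 1) * (rt + ra) = m * (rt + ra) + (rt + ra) by ring]
    exact mul_mem_graphBall S ih hstep

/-! ## §3 Independence of `c_1, …, c_m` makes `ε ↦ P_m(ε)` injective -/

/-- `P_m(ε) ∈ ⟨c_i : i < m+1⟩`. [cite: MilnorSolvableGrowth1968, p. 448] -/
theorem wordProd_mem (t a : Γ) : ∀ (m : ℕ) (ε : Fin m → Bool),
    wordProd t a m ε ∈ Subgroup.closure (conj t a '' Set.Iio (m + 1))
  | 0, _ => by rw [wordProd]; exact one_mem _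
  | m + 1, ε => by
    have ih := wordProd_mem t a m (Fin.init ε)
    have hmono : Subgroup.closure (conj t a '' Set.Iio (m + 1)) ≤ Subgroup.closure (conj t a '' Set.Iio (m + 1 + 1)) :=
      Subgroup.closure_mono (Set.image_mono (Set.Iio_subset_Iio (by omega)))
    rw [wordProd]
    refine mul_mem (hmono ih) ?_
    split_ifs
    · exact Subgroup.subset_closure ⟨m + 1, by simp, rfl⟩
    · exact one_mem _

/-- **Independence ⟹ injectivity**: if `c_{j+1} ∉ ⟨c_i : i ≤ j⟩` for all `j < m`, then `ε ↦ P_m(ε)` is injective on `{0,1}^m`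
(induction on `m`, comparing last letters). [cite: MilnorSolvableGrowth1968, p. 448 (minimal m, i_m ≠ j_m)] -/
theorem wordProd_injective (t a : Γ) : ∀ m : ℕ,
    (∀ j < m, conj t a (j + 1) ∉ Subgroup.closure (conj t a '' Set.Iio (j + 1))) → Function.Injective (wordProd t a m)
  | 0, _ => fun ε δ _ => funext fun i => i.elim0
  | m + 1, hind => by
    intro ε δ h
    have ih := wordProd_injective t a m (fun j hj => hind j (by omega))
    simp only [wordProd] at h
    have key : Fin.init ε = Fin.init δ ∧ ε (Fin.last m) = δ (Fin.last m) := by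
      cases hε : ε (Fin.last m) <;> cases hδ : δ (Fin.last m)
      · simp only [hε, hδ, Bool.false_eq_true, ↓reduceIte, mul_one] at h
        exact ⟨ih h, rfl⟩
      · exfalso
        simp only [hε, hδ, Bool.false_eq_true, ↓reduceIte, mul_one] at h
        refine hind m (by omega) ?_
        have e : conj t a (m + 1) = (wordProd t a m (Fin.init δ))⁻¹ * wordProd t a m (Fin.init ε) := by
          rw [h, inv_mul_cancel_left]
        rw [e]
        exact mul_mem (inv_mem (wordProd_mem t a m _)) (wordProd_mem t a m _)
      · exfalso
        simp only [hε, hδ, Bool.false_eq_true, ↓reduceIte, mul_one] at h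
        refine hind m (by omega) ?_
        have e : conj t a (m + 1) = (wordProd t a m (Fin.init ε))⁻¹ * wordProd t a m (Fin.init δ) := by
          rw [← h, inv_mul_cancel_left]
        rw [e]
        exact mul_mem (inv_mem (wordProd_mem t a m _)) (wordProd_mem t a m _)
      · simp only [hε, hδ, ↓reduceIte] at h
        exact ⟨ih (mul_right_cancel h), rfl⟩
    calc ε = Fin.snoc (Fin.init ε) (ε (Fin.last m)) := (Fin.snoc_init_self ε).symm
      _ = Fin.snoc (Fin.init δ) (δ (Fin.last m)) := by rw [key.1, key.2]
      _ = δ := Fin.snoc_init_self δ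

/-! ## §4 Propagation: `c_n ∈ ⟨c_i : i < n⟩` forces every `c_k` into `⟨c_i : i < n⟩` -/

/-- Conjugation into a subgroup is checked on generators. [folklore] -/
theorem conj_mem_of_closure {X : Set Γ} {H : Subgroup Γ} {g : Γ} (hX : ∀ x ∈ X, g * x * g⁻¹ ∈ H) {y : Γ}
    (hy : y ∈ Subgroup.closure X) : g * y * g⁻¹ ∈ H := by
  induction hy using Subgroup.closure_induction with
  | mem x hx => exact hX x hx
  | one => rw [mul_one, mul_inv_cancel]; exact one_mem H
  | mul x y _ _ hx hy =>
    have e : g * (x * y) * g⁻¹ = (g * x * g⁻¹) * (g * y * g⁻¹) := by group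
    rw [e]; exact mul_mem hx hy
  | inv x _ hx =>
    have e : g * x⁻¹ * g⁻¹ = (g * x * g⁻¹)⁻¹ := by group
    rw [e]; exact inv_mem hx

/-- **Milnor's induction**: if `c_n ∈ ⟨c_i : i < n⟩` then `c_k ∈ ⟨c_i : i < n⟩` for EVERY `k ≥ 0` (`c_k = t^{k−n} c_n t^{n−k}` and the
conjugated generators have smaller index). [cite: MilnorSolvableGrowth1968, p. 448 ("Continuing inductively …")] -/
theorem conj_mem_closure_of_mem (t a : Γ) {n : ℕ} (hn : conj t a n ∈ Subgroup.closure (conj t a '' Set.Iio n)) (k : ℕ) :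
    conj t a k ∈ Subgroup.closure (conj t a '' Set.Iio n) := by
  induction k using Nat.strong_induction_on with
  | _ k ih =>
    by_cases hk : k < n
    · exact Subgroup.subset_closure ⟨k, hk, rfl⟩
    · obtain ⟨d, rfl⟩ : ∃ d, k = n + d := ⟨k - n, by omega⟩
      rw [conj_add]
      refine conj_mem_of_closure (fun x hx => ?_) hn
      obtain ⟨i, hi, rfl⟩ := hx
      rw [← conj_add]
      exact ih (i + d) (by simp only [Set.mem_Iio] at hi; omega)

/-- Hence `⟨c_k : k ≥ 0⟩ ≤ ⟨c_i : i < n⟩`. [cite: MilnorSolvableGrowth1968, Lemma 1] -/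
theorem closure_range_conj_le (t a : Γ) {n : ℕ} (hn : conj t a n ∈ Subgroup.closure (conj t a '' Set.Iio n)) :
    Subgroup.closure (Set.range (conj t a)) ≤ Subgroup.closure (conj t a '' Set.Iio n) :=
  (Subgroup.closure_le _).2 (by rintro _ ⟨k, rfl⟩; exact conj_mem_closure_of_mem t a hn k)

/-! ## §5 Growth: `2^m` distinct words of length `≤ mR` for every `m` is exponential growth -/

/-- A length bound `R ≥ 1` for the telescoped words of `t, a`. [cite: MilnorSolvableGrowth1968, p. 447] -/
theorem exists_radius (hS : Subgroup.closure (S : Set Γ) = ⊤) (t a : Γ) : ∃ R : ℕ, 1 ≤ R ∧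
    ∀ (m : ℕ) (ε : Fin m → Bool), wordProd t a m ε * t ^ m ∈ graphBall (mulCayley (S : Set Γ)) 1 (m * R) := by
  obtain ⟨rt, ht⟩ := exists_mem_graphBall S hS t
  obtain ⟨ra, ha⟩ := exists_mem_graphBall S hS a
  exact ⟨rt + ra + 1, by omega, fun m ε =>
    graphBall_mono _ _ (Nat.mul_le_mul_left m (by omega)) (wordProd_mul_pow_mem S t a ht ha m ε)⟩

/-- **Injective words fill balls**: `2^m ≤ |B(x, mR)|` at every vertex `x`. [cite: MilnorSolvableGrowth1968, p. 447 (g_S(m·const) ≥ 2^m)] -/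
theorem two_pow_le_ballVolume {t a : Γ} {R m : ℕ}
    (hR : ∀ ε : Fin m → Bool, wordProd t a m ε * t ^ m ∈ graphBall (mulCayley (S : Set Γ)) 1 (m * R))
    (hinj : Function.Injective (wordProd t a m)) (x : Γ) : 2 ^ m ≤ ballVolume (mulCayley (S : Set Γ)) x (m * R) := by
  set F : (Fin m → Bool) → Γ := fun ε => x * (wordProd t a m ε * t ^ m) with hF_def
  have hF : Function.Injective F := by
    intro ε δ h
    exact hinj (mul_right_cancel (mul_left_cancel h))
  have hsub : Set.range F ⊆ graphBall (mulCayley (S : Set Γ)) x (m * R) := by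
    rintro _ ⟨ε, rfl⟩
    exact mul_mem_graphBall_left S x (hR ε)
  calc 2 ^ m = (Set.range F).ncard := by
        rw [← Set.image_univ, Set.ncard_image_of_injective _ hF, Set.ncard_univ, Nat.card_eq_fintype_card]
        simp
    _ ≤ ballVolume (mulCayley (S : Set Γ)) x (m * R) := Set.ncard_le_ncard hsub (graphBall_finite _ x _)

/-- **`2^m ≤ |B(x, mR)|` for all `m` and `x` is exponential growth** (rate `2^{1/(2R)}`).
[cite: MilnorSolvableGrowth1968, p. 447 (g_S(m) > (const)^m)] [cite: Hutchcroft2016, §1 (exponential growth)] -/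
theorem hasExponentialGrowth_of_two_pow_le {V : Type*} (G : SimpleGraph V) [G.LocallyFinite] {R : ℕ} (hR : 1 ≤ R)
    (h : ∀ (x : V) (m : ℕ), 2 ^ m ≤ ballVolume G x (m * R)) : HasExponentialGrowth G := by
  intro x
  have hRpos : (0 : ℝ) < R := by exact_mod_cast hR
  refine ⟨(2 : ℝ) ^ ((1 : ℝ) / (2 * R)), Real.one_lt_rpow one_lt_two (by positivity), ?_⟩
  refine eventually_atTop.2 ⟨2 * R, fun n hn => ?_⟩
  set m := n / R with hm
  have hmR : m * R ≤ n := Nat.div_mul_le_self n R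
  have hlt : n < m * R + R := Nat.lt_div_mul_add hR
  have h1 : (n : ℝ) / R - 1 < m := by
    have hlt' : (n : ℝ) < ((m : ℝ) + 1) * R := by
      have h' : n < (m + 1) * R := by rw [add_mul, one_mul]; exact hlt
      exact_mod_cast h'
    rw [sub_lt_iff_lt_add, div_lt_iff₀ hRpos]
    exact hlt'
  have h2 : (1 : ℝ) ≤ n / (2 * R) := by
    rw [le_div_iff₀ (by positivity), one_mul]
    exact_mod_cast hn
  have h3 : (n : ℝ) / (2 * R) ≤ m := by
    have e : (n : ℝ) / (2 * R) = n / R - n / (2 * R) := by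
      field_simp
      ring
    linarith
  calc ((2 : ℝ) ^ ((1 : ℝ) / (2 * R))) ^ n = (2 : ℝ) ^ ((n : ℝ) / (2 * R)) := by
        rw [← Real.rpow_natCast, ← Real.rpow_mul (by norm_num : (0 : ℝ) ≤ 2)]
        congr 1
        field_simp
    _ ≤ (2 : ℝ) ^ (m : ℝ) := Real.rpow_le_rpow_of_exponent_le one_le_two h3
    _ = ((2 ^ m : ℕ) : ℝ) := by rw [Real.rpow_natCast]; push_cast; rfl
    _ ≤ ballVolume G x (m * R) := by exact_mod_cast h x m
    _ ≤ ballVolume G x n := by exact_mod_cast ballVolume_mono G x hmR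

/-! ## §6 Conclusions: off exponential growth the conjugates span a finitely generated subgroup -/

/-- **MILNOR'S LEMMA (positive powers)**: if `Cay(Γ; S)` does not have exponential growth, then for all `t, a ∈ Γ` some conjugate `c_n`
lies in `⟨c_i : i < n⟩`. [cite: MilnorSolvableGrowth1968, Lemma 1 pp. 447–448] [cite: Rosset1976, Thm. 1] -/
theorem exists_conj_mem_closure (hS : Subgroup.closure (S : Set Γ) = ⊤) (hG : ¬ HasExponentialGrowth (mulCayley (S : Set Γ)))
    (t a : Γ) : ∃ n, conj t a n ∈ Subgroup.closure (conj t a '' Set.Iio n) := by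
  by_contra hne
  push Not at hne
  obtain ⟨R, hR1, hR⟩ := exists_radius S hS t a
  exact hG (hasExponentialGrowth_of_two_pow_le _ hR1 fun x m =>
    two_pow_le_ballVolume S (hR m) (wordProd_injective t a m fun j _ => hne (j + 1)) x)

/-- **MILNOR'S LEMMA (all integer powers)**: if `Cay(Γ; S)` does not have exponential growth, then for all `t, a ∈ Γ` there is a FINITE
set `F` of conjugates `t^k a t^{-k}` whose span contains every conjugate `t^k a t^{-k}`, `k ∈ ℤ`.
[cite: MilnorSolvableGrowth1968, Lemma 1 pp. 447–448] [cite: Rosset1976, Thm. 1] -/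
theorem exists_finset_conj (hS : Subgroup.closure (S : Set Γ) = ⊤) (hG : ¬ HasExponentialGrowth (mulCayley (S : Set Γ)))
    (t a : Γ) : ∃ F : Finset Γ, (∀ f ∈ F, ∃ k : ℤ, f = t ^ k * a * (t ^ k)⁻¹) ∧
      ∀ k : ℤ, t ^ k * a * (t ^ k)⁻¹ ∈ Subgroup.closure (F : Set Γ) := by
  obtain ⟨n₁, hn₁⟩ := exists_conj_mem_closure S hS hG t a
  obtain ⟨n₂, hn₂⟩ := exists_conj_mem_closure S hS hG t⁻¹ a
  refine ⟨(Finset.range n₁).image (conj t a) ∪ (Finset.range n₂).image (conj t⁻¹ a), ?_, ?_⟩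
  · intro f hf
    rcases Finset.mem_union.1 hf with hf | hf
    · obtain ⟨j, -, rfl⟩ := Finset.mem_image.1 hf
      exact ⟨j, conj_eq_zpow t a j⟩
    · obtain ⟨j, -, rfl⟩ := Finset.mem_image.1 hf
      exact ⟨-(j : ℤ), conj_inv_eq_zpow t a j⟩
  · have h₁ : Subgroup.closure (conj t a '' Set.Iio n₁) ≤
        Subgroup.closure (↑((Finset.range n₁).image (conj t a) ∪ (Finset.range n₂).image (conj t⁻¹ a)) : Set Γ) := by
      refine Subgroup.closure_mono ?_
      rintro _ ⟨i, hi, rfl⟩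
      rw [Finset.coe_union, Finset.coe_image, Finset.coe_image]
      exact Or.inl ⟨i, by simpa using hi, rfl⟩
    have h₂ : Subgroup.closure (conj t⁻¹ a '' Set.Iio n₂) ≤
        Subgroup.closure (↑((Finset.range n₁).image (conj t a) ∪ (Finset.range n₂).image (conj t⁻¹ a)) : Set Γ) := by
      refine Subgroup.closure_mono ?_
      rintro _ ⟨i, hi, rfl⟩
      rw [Finset.coe_union, Finset.coe_image, Finset.coe_image]
      exact Or.inr ⟨i, by simpa using hi, rfl⟩
    intro k
    rcases Int.eq_nat_or_neg k with ⟨j, rfl | rfl⟩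
    · rw [← conj_eq_zpow]
      exact h₁ (closure_range_conj_le t a hn₁ (Subgroup.subset_closure ⟨j, rfl⟩))
    · rw [← conj_inv_eq_zpow]
      exact h₂ (closure_range_conj_le t⁻¹ a hn₂ (Subgroup.subset_closure ⟨j, rfl⟩))

end Milnor

end Summit.CriticalPhenomena.PercolationContinuityZ3.Theorems.Transplant

end
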